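/-
Copyright (c) 2026. All rights reserved.
Released under Apache 2.0 license as described in the file LICENSE.
Authors: abc-iut cell — seat abc-iut-w4-d104 (gen 2): proof-only companion to `HolomorphicCores`
([AbsTopIII] Prop 2.5 (d)) over abc-iut-L6-t15's `ParallelogramsPlanar*` chain; no new definitions.
-/
import Literature.AnabelianGeometry.AbsoluteAnabelian.ParallelogramsPlanarOrientations
import HarnessLib

/-!
# Planar geometry behind [AbsTopIII] Prop 2.5: the two orientations ARE the two determinant signs

S. Mochizuki, *Topics in absolute anabelian geometry III*, Prop. 2.5 (d) (kurims p.56; bib key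
`MochizukiAbsTopIII2015`): "… the orientations of `U` at `p` [of which there are precisely 2]".

Proof-only companion (no definitions) to `HolomorphicCores.lean` (abc-iut-L4-t14), continuing
abc-iut-L6-t15's `ParallelogramsPlanarOrientations` (`nonempty_orientations_equiv_bool`: `|Orientations| = 2`,
proved there with the determinant-sign map INTERNALLY).  Here the classifying statement is EXPORTED for
arbitrary frames (presented by corner vectors as in L6-t15's API: `val '' P = openParallelogram p e₁ e₂`,
`val '' Sᵢ = [p, p + eᵢ]`), for an open `U ⊆ ℂ`, any `𝒮(U) ⊆ 𝒬 ⊆ 𝒫(U)` and `p ∈ U`: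

* `Parallelograms.det_pos_iff_of_orientation_eq`: same class in `Orientations 𝒬 p` ⇒ same sign of
  `det(e₁, e₂)` (induction on the equivalence GENERATED by strict co-orientation, one
  `StrictlyCoOriented.det_pos_iff` per step);
* `Parallelograms.orientation_eq_of_det_pos_iff`: same sign ⇒ same class (two classes only, and a frame
  of the opposite sign lies in neither);
* `Parallelograms.orientation_eq_iff_det_pos_iff`: the classification; `exists_orientation_ne`.

Used by the Prop 2.6 bridge `HolomorphicCoresOrientationBridge.lean` (this seat).  Refereed pre-IUT
material; nothing here bears on the disputed [IUTchIII] Cor. 3.12; typed ≠ endorsed.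
-/

namespace Literature.AnabelianGeometry.AbsoluteAnabelian

open _root_.Complex _root_.Set _root_.Topology _root_.Filter _root_.Metric

noncomputable section

/-! ### Prop 2.5 (d): presentation vectors of a frame are unique; presenting sets lie in `U` -/

/-- The corner vectors presenting the two sides of a frame are determined by the frame.
(Auxiliary.) [cite: MochizukiAbsTopIII2015, Proposition 2.5 (d) p.56] -/
theorem Parallelograms.frame_vectors_unique {U : Set ℂ} {p : U} {F : Set U × Set U}
    {e₁ e₂ e₁' e₂' : ℂ} (he : LinearIndependent ℝ ![e₁, e₂])
    (h₁ : Subtype.val '' F.1 = segment ℝ (p : ℂ) (p + e₁))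
    (h₂ : Subtype.val '' F.2 = segment ℝ (p : ℂ) (p + e₂))
    (h₁' : Subtype.val '' F.1 = segment ℝ (p : ℂ) (p + e₁'))
    (h₂' : Subtype.val '' F.2 = segment ℝ (p : ℂ) (p + e₂')) :
    e₁' = e₁ ∧ e₂' = e₂ :=
  ⟨eq_of_segment_eq_segment (by simpa using he.ne_zero 0) (h₁'.symm.trans h₁),
    eq_of_segment_eq_segment (by simpa using he.ne_zero 1) (h₂'.symm.trans h₂)⟩

/-- If the closed parallelogram with corner `p` and edges `(a, b)` lies in `U`, then so do the open
parallelogram and the two sides `[p, p + a]`, `[p, p + b]`. (Auxiliary.)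
[cite: MochizukiAbsTopIII2015, Proposition 2.5 (d) p.56] -/
theorem subsets_of_closure_openParallelogram_subset {U : Set ℂ} {p a b : ℂ}
    (hab : LinearIndependent ℝ ![a, b]) (hcl : closure (openParallelogram p a b) ⊆ U) :
    openParallelogram p a b ⊆ U ∧ segment ℝ p (p + a) ⊆ U ∧ segment ℝ p (p + b) ⊆ U := by
  have hm := fun s t (hs : (0:ℝ) ≤ s) (hs1 : s ≤ 1) (ht : (0:ℝ) ≤ t) (ht1 : t ≤ 1) =>
    (mem_closure_openParallelogram_iff hab (x := p + (s : ℂ) * a + (t : ℂ) * b)).2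
      ⟨s, t, hs, hs1, ht, ht1, rfl⟩
  have hK := convex_closure_openParallelogram p a b
  have h0 : p ∈ closure (openParallelogram p a b) := by
    simpa using hm 0 0 le_rfl zero_le_one le_rfl zero_le_one
  exact ⟨subset_closure.trans hcl,
    (hK.segment_subset h0 (by simpa using hm 1 0 zero_le_one le_rfl le_rfl zero_le_one)).trans hcl,
    (hK.segment_subset h0 (by simpa using hm 0 1 le_rfl zero_le_one zero_le_one le_rfl)).trans hcl⟩

/-- `val '' (val ⁻¹' S) = S` for `S ⊆ U`. (Auxiliary.) [cite: MochizukiAbsTopIII2015, Proposition 2.5 (d) p.56] -/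
theorem image_val_preimage_val_of_subset {U : Set ℂ} {S : Set ℂ} (hS : S ⊆ U) :
    Subtype.val '' (Subtype.val ⁻¹' S : Set U) = S := by
  rw [image_preimage_eq_inter_range, Subtype.range_coe, inter_eq_left.2 hS]

/-! ### Prop 2.5 (d): the two orientations are the two determinant signs -/

section Orientation

variable {U : Set ℂ} (hU : IsOpen U) {𝒬 : Set (Set U)}
  (h𝒬 : ∀ Q ∈ 𝒬, Subtype.val '' Q ∈ parallelogramsIn U)
  (h𝒮 : ∀ Q : Set U, Subtype.val '' Q ∈ squaresIn U → Q ∈ 𝒬)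

include hU h𝒬 h𝒮 in
/-- **Prop 2.5 (d)**, orientation classes ⇒ signs: if two frames at `p` (with their parallelograms) lie
in the same class of `Orientations 𝒬 p` — the equivalence relation GENERATED by strict co-orientation —
then the determinants of their corner vectors have the same sign.  (Induction on the generated
equivalence, one `StrictlyCoOriented.det_pos_iff` per step; intermediate frames get corner vectors from
`IsFrameOf.exists_vectors`.) [cite: MochizukiAbsTopIII2015, Proposition 2.5 (d) p.56] -/
theorem Parallelograms.det_pos_iff_of_orientation_eq {p : U}
    {F F' : {PF : Set U × (Set U × Set U) // Parallelograms.IsFrameOf 𝒬 p PF.1 PF.2}}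
    (h : (Quot.mk _ F : Parallelograms.Orientations 𝒬 p) = Quot.mk _ F')
    {e₁ e₂ e₁' e₂' : ℂ} (he : LinearIndependent ℝ ![e₁, e₂]) (he' : LinearIndependent ℝ ![e₁', e₂'])
    (hP : Subtype.val '' F.1.1 = openParallelogram (p : ℂ) e₁ e₂)
    (h₁ : Subtype.val '' F.1.2.1 = segment ℝ (p : ℂ) (p + e₁))
    (h₂ : Subtype.val '' F.1.2.2 = segment ℝ (p : ℂ) (p + e₂))
    (hP' : Subtype.val '' F'.1.1 = openParallelogram (p : ℂ) e₁' e₂')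
    (h₁' : Subtype.val '' F'.1.2.1 = segment ℝ (p : ℂ) (p + e₁'))
    (h₂' : Subtype.val '' F'.1.2.2 = segment ℝ (p : ℂ) (p + e₂')) :
    (0 < e₁.re * e₂.im - e₁.im * e₂.re ↔ 0 < e₁'.re * e₂'.im - e₁'.im * e₂'.re) := by
  have hgen := Quot.eqvGen_exact h
  -- the motive, generalised over the presenting vectors
  suffices key : ∀ G G' : {PF : Set U × (Set U × Set U) // Parallelograms.IsFrameOf 𝒬 p PF.1 PF.2},
      Relation.EqvGen (fun F F' => Parallelograms.StrictlyCoOriented 𝒬 F.1.1 F.1.2 F'.1.1 F'.1.2) G G' →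
      ∀ (f₁ f₂ g₁ g₂ : ℂ), LinearIndependent ℝ ![f₁, f₂] → LinearIndependent ℝ ![g₁, g₂] →
        Subtype.val '' G.1.1 = openParallelogram (p : ℂ) f₁ f₂ →
        Subtype.val '' G.1.2.1 = segment ℝ (p : ℂ) (p + f₁) →
        Subtype.val '' G.1.2.2 = segment ℝ (p : ℂ) (p + f₂) →
        Subtype.val '' G'.1.1 = openParallelogram (p : ℂ) g₁ g₂ →
        Subtype.val '' G'.1.2.1 = segment ℝ (p : ℂ) (p + g₁) →
        Subtype.val '' G'.1.2.2 = segment ℝ (p : ℂ) (p + g₂) →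
        (0 < f₁.re * f₂.im - f₁.im * f₂.re ↔ 0 < g₁.re * g₂.im - g₁.im * g₂.re) from
    key F F' hgen e₁ e₂ e₁' e₂' he he' hP h₁ h₂ hP' h₁' h₂'
  intro G G' hGG'
  induction hGG' with
  | rel x y hxy =>
    intro f₁ f₂ g₁ g₂ hf hg hPf _ h₂f hPg h₁g _
    exact Parallelograms.StrictlyCoOriented.det_pos_iff hxy hf hg hPf h₂f hPg h₁g
  | refl x =>
    intro f₁ f₂ g₁ g₂ hf _ _ h₁f h₂f _ h₁g h₂g
    obtain ⟨rfl, rfl⟩ := Parallelograms.frame_vectors_unique hf h₁f h₂f h₁g h₂g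
    exact Iff.rfl
  | symm x y _ ih =>
    intro f₁ f₂ g₁ g₂ hf hg hPf h₁f h₂f hPg h₁g h₂g
    exact (ih g₁ g₂ f₁ f₂ hg hf hPg h₁g h₂g hPf h₁f h₂f).symm
  | trans x y z _ _ ih₁ ih₂ =>
    intro f₁ f₂ g₁ g₂ hf hg hPf h₁f h₂f hPg h₁g h₂g
    obtain ⟨m₁, m₂, hm, hPm, -, h₁m, h₂m⟩ := Parallelograms.IsFrameOf.exists_vectors hU h𝒬 h𝒮 y.2
    exact (ih₁ f₁ f₂ m₁ m₂ hf hm hPf h₁f h₂f hPm h₁m h₂m).trans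
      (ih₂ m₁ m₂ g₁ g₂ hm hg hPm h₁m h₂m hPg h₁g h₂g)

include hU in
/-- At every point of an open `U ⊆ ℂ` there are corner frames of BOTH determinant signs with closures in
`U` (small squares `(ε, εi)` and `(εi, ε)`). (Auxiliary.)
[cite: MochizukiAbsTopIII2015, Proposition 2.5 (d) p.56] -/
theorem exists_frames_both_signs (p : U) :
    ∃ e₁ e₂ : ℂ, LinearIndependent ℝ ![e₁, e₂] ∧ LinearIndependent ℝ ![e₂, e₁] ∧
      closure (openParallelogram (p : ℂ) e₁ e₂) ⊆ U ∧ closure (openParallelogram (p : ℂ) e₂ e₁) ⊆ U ∧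
      0 < e₁.re * e₂.im - e₁.im * e₂.re ∧ e₂.re * e₁.im - e₂.im * e₁.re < 0 := by
  obtain ⟨ε, hε, h₁, h₂⟩ := exists_small_corner_squares hU (p := (p : ℂ)) p.2
  have hli : LinearIndependent ℝ ![((ε : ℝ) : ℂ), ((ε : ℝ) : ℂ) * I] := by
    have := linearIndependent_pair_mul_I (v := ((ε : ℝ) : ℂ)) (by exact_mod_cast hε.ne')
    simpa [mul_comm] using this
  refine ⟨(ε : ℂ), (ε : ℂ) * I, hli, LinearIndependent.pair_symm_iff.mp hli, h₁, h₂, ?_, ?_⟩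
  · simp only [Complex.ofReal_re, Complex.mul_im, Complex.ofReal_im, Complex.I_re, Complex.I_im,
      Complex.mul_re]
    nlinarith
  · simp only [Complex.ofReal_re, Complex.mul_im, Complex.ofReal_im, Complex.I_re, Complex.I_im,
      Complex.mul_re]
    nlinarith

include hU h𝒬 h𝒮 in
/-- **Prop 2.5 (d)**, signs ⇒ orientation classes: two frames at `p` whose corner vectors have
determinants of the SAME sign lie in the same class of `Orientations 𝒬 p`.  (There are exactly two
classes — `nonempty_orientations_equiv_bool` — and a frame of the opposite sign lies in neither of the
two classes in question by `det_pos_iff_of_orientation_eq`; three pairwise distinct classes are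
impossible.) [cite: MochizukiAbsTopIII2015, Proposition 2.5 (d) p.56] -/
theorem Parallelograms.orientation_eq_of_det_pos_iff {p : U}
    {F F' : {PF : Set U × (Set U × Set U) // Parallelograms.IsFrameOf 𝒬 p PF.1 PF.2}}
    {e₁ e₂ e₁' e₂' : ℂ} (he : LinearIndependent ℝ ![e₁, e₂]) (he' : LinearIndependent ℝ ![e₁', e₂'])
    (hP : Subtype.val '' F.1.1 = openParallelogram (p : ℂ) e₁ e₂)
    (h₁ : Subtype.val '' F.1.2.1 = segment ℝ (p : ℂ) (p + e₁))
    (h₂ : Subtype.val '' F.1.2.2 = segment ℝ (p : ℂ) (p + e₂))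
    (hP' : Subtype.val '' F'.1.1 = openParallelogram (p : ℂ) e₁' e₂')
    (h₁' : Subtype.val '' F'.1.2.1 = segment ℝ (p : ℂ) (p + e₁'))
    (h₂' : Subtype.val '' F'.1.2.2 = segment ℝ (p : ℂ) (p + e₂'))
    (hsign : (0 < e₁.re * e₂.im - e₁.im * e₂.re ↔ 0 < e₁'.re * e₂'.im - e₁'.im * e₂'.re)) :
    (Quot.mk _ F : Parallelograms.Orientations 𝒬 p) = Quot.mk _ F' := by
  classical
  obtain ⟨φ⟩ := Parallelograms.nonempty_orientations_equiv_bool hU h𝒬 h𝒮 p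
  by_contra hne
  -- a frame of the sign opposite to that of `e` (hence of `e'`)
  obtain ⟨a₁, a₂, ha, ha', hca, hca', hapos, haneg⟩ := exists_frames_both_signs hU p
  obtain ⟨g₁, g₂, hg, hcg, hgsign⟩ : ∃ g₁ g₂ : ℂ, ∃ hg : LinearIndependent ℝ ![g₁, g₂],
      closure (openParallelogram (p : ℂ) g₁ g₂) ⊆ U ∧
      ¬ (0 < g₁.re * g₂.im - g₁.im * g₂.re ↔ 0 < e₁.re * e₂.im - e₁.im * e₂.re) := by
    by_cases hpos : 0 < e₁.re * e₂.im - e₁.im * e₂.re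
    · exact ⟨a₂, a₁, ha', hca', fun h => absurd (h.2 hpos) (not_lt.2 haneg.le)⟩
    · exact ⟨a₁, a₂, ha, hca, fun h => hpos (h.1 hapos)⟩
  obtain ⟨hPg, hS₁g, hS₂g⟩ := subsets_of_closure_openParallelogram_subset hg hcg
  -- the frame of `g` and the three classes
  let G : {PF : Set U × (Set U × Set U) // Parallelograms.IsFrameOf 𝒬 p PF.1 PF.2} :=
    ⟨(Subtype.val ⁻¹' openParallelogram (p : ℂ) g₁ g₂,
      (Subtype.val ⁻¹' segment ℝ (p : ℂ) (p + g₁), Subtype.val ⁻¹' segment ℝ (p : ℂ) (p + g₂))),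
      Parallelograms.isFrameOf_of_vectors hU h𝒬 h𝒮 hg hcg⟩
  have hGE : (Quot.mk _ G : Parallelograms.Orientations 𝒬 p) ≠ Quot.mk _ F := fun hq =>
    hgsign (Parallelograms.det_pos_iff_of_orientation_eq hU h𝒬 h𝒮 hq hg he
      (image_val_preimage_val_of_subset hPg) (image_val_preimage_val_of_subset hS₁g)
      (image_val_preimage_val_of_subset hS₂g) hP h₁ h₂)
  have hGF : (Quot.mk _ G : Parallelograms.Orientations 𝒬 p) ≠ Quot.mk _ F' := fun hq =>
    hgsign ((Parallelograms.det_pos_iff_of_orientation_eq hU h𝒬 h𝒮 hq hg he'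
      (image_val_preimage_val_of_subset hPg) (image_val_preimage_val_of_subset hS₁g)
      (image_val_preimage_val_of_subset hS₂g) hP' h₁' h₂').trans hsign.symm)
  have h1 : φ (Quot.mk _ G) ≠ φ (Quot.mk _ F) := fun h => hGE (φ.injective h)
  have h2 : φ (Quot.mk _ G) ≠ φ (Quot.mk _ F') := fun h => hGF (φ.injective h)
  have h3 : φ (Quot.mk _ F) ≠ φ (Quot.mk _ F') := fun h => hne (φ.injective h)
  -- three pairwise distinct Booleans do not exist
  have key : ∀ x y z : Bool, x ≠ y → x ≠ z → y ≠ z → False := by decide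
  exact key _ _ _ h1 h2 h3

include hU h𝒬 h𝒮 in
/-- **Prop 2.5 (d) — the two orientations are the two determinant signs**: two frames at `p` lie in the
same class of `Orientations 𝒬 p` IFF the determinants of their corner vectors have the same sign.
[cite: MochizukiAbsTopIII2015, Proposition 2.5 (d) p.56] -/
theorem Parallelograms.orientation_eq_iff_det_pos_iff {p : U}
    {F F' : {PF : Set U × (Set U × Set U) // Parallelograms.IsFrameOf 𝒬 p PF.1 PF.2}}
    {e₁ e₂ e₁' e₂' : ℂ} (he : LinearIndependent ℝ ![e₁, e₂]) (he' : LinearIndependent ℝ ![e₁', e₂'])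
    (hP : Subtype.val '' F.1.1 = openParallelogram (p : ℂ) e₁ e₂)
    (h₁ : Subtype.val '' F.1.2.1 = segment ℝ (p : ℂ) (p + e₁))
    (h₂ : Subtype.val '' F.1.2.2 = segment ℝ (p : ℂ) (p + e₂))
    (hP' : Subtype.val '' F'.1.1 = openParallelogram (p : ℂ) e₁' e₂')
    (h₁' : Subtype.val '' F'.1.2.1 = segment ℝ (p : ℂ) (p + e₁'))
    (h₂' : Subtype.val '' F'.1.2.2 = segment ℝ (p : ℂ) (p + e₂')) :
    (Quot.mk _ F : Parallelograms.Orientations 𝒬 p) = Quot.mk _ F' ↔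
      (0 < e₁.re * e₂.im - e₁.im * e₂.re ↔ 0 < e₁'.re * e₂'.im - e₁'.im * e₂'.re) :=
  ⟨fun h => Parallelograms.det_pos_iff_of_orientation_eq hU h𝒬 h𝒮 h he he' hP h₁ h₂ hP' h₁' h₂',
    Parallelograms.orientation_eq_of_det_pos_iff hU h𝒬 h𝒮 he he' hP h₁ h₂ hP' h₁' h₂'⟩

/-- Both orientation classes are realised: there are frames at `p` in DIFFERENT classes (restated from
the sign classification; cf. `nonempty_orientations_equiv_bool`). (Auxiliary.)
[cite: MochizukiAbsTopIII2015, Proposition 2.5 (d) p.56] -/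
theorem Parallelograms.exists_orientation_ne (hU : IsOpen U)
    (h𝒬 : ∀ Q ∈ 𝒬, Subtype.val '' Q ∈ parallelogramsIn U)
    (h𝒮 : ∀ Q : Set U, Subtype.val '' Q ∈ squaresIn U → Q ∈ 𝒬) (p : U) :
    ∃ F F' : {PF : Set U × (Set U × Set U) // Parallelograms.IsFrameOf 𝒬 p PF.1 PF.2},
      (Quot.mk _ F : Parallelograms.Orientations 𝒬 p) ≠ Quot.mk _ F' := by
  obtain ⟨a₁, a₂, ha, ha', hca, hca', hapos, haneg⟩ := exists_frames_both_signs hU p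
  obtain ⟨hPa, hS₁a, hS₂a⟩ := subsets_of_closure_openParallelogram_subset ha hca
  obtain ⟨hPa', hS₁a', hS₂a'⟩ := subsets_of_closure_openParallelogram_subset ha' hca'
  refine ⟨⟨(Subtype.val ⁻¹' openParallelogram (p : ℂ) a₁ a₂,
      (Subtype.val ⁻¹' segment ℝ (p : ℂ) (p + a₁), Subtype.val ⁻¹' segment ℝ (p : ℂ) (p + a₂))),
      Parallelograms.isFrameOf_of_vectors hU h𝒬 h𝒮 ha hca⟩,
    ⟨(Subtype.val ⁻¹' openParallelogram (p : ℂ) a₂ a₁,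
      (Subtype.val ⁻¹' segment ℝ (p : ℂ) (p + a₂), Subtype.val ⁻¹' segment ℝ (p : ℂ) (p + a₁))),
      Parallelograms.isFrameOf_of_vectors hU h𝒬 h𝒮 ha' hca'⟩, fun h => ?_⟩
  have := Parallelograms.det_pos_iff_of_orientation_eq hU h𝒬 h𝒮 h ha ha'
    (image_val_preimage_val_of_subset hPa) (image_val_preimage_val_of_subset hS₁a)
    (image_val_preimage_val_of_subset hS₂a) (image_val_preimage_val_of_subset hPa')
    (image_val_preimage_val_of_subset hS₁a') (image_val_preimage_val_of_subset hS₂a')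
  exact absurd (this.1 hapos) (not_lt.2 haneg.le)

end Orientation


end

end Literature.AnabelianGeometry.AbsoluteAnabelian
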